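import Literature.NumberTheory.GelbartRogawski1991.DoubledWeilRepresentationLocalFamilyCM
import Literature.NumberTheory.GelbartRogawski1991.DoubledWeilRepresentationAssembly
import Literature.NumberTheory.GelbartRogawski1991.DoubledWeilRepresentationFiniteHalf
import Literature.NumberTheory.GelbartRogawski1991.DoubledWeilRepresentationUniqueness
import HarnessLib

-- buildfix G11b-3 recipe (LEDGER B13-1/B13-3): elaborate sequentially so the trailing `attribute [implicit_reducible]`
-- block (reducibilityCoreExt is keyed to the async environment branch) is in force at `.olean` export.
set_option Elab.async false

/-!
# The doubled Weil representation at the CM dual-pair datum, EXPLICITLY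

[GelbartRogawski1991, §3.1 Prop. 3.1.1] by doubling, CM specialisation, explicit form.  The sibling modules prove the
EXISTENCE of a `χ`-normalised doubled Weil representation `s^𝔻 : H(𝔸) →* Mp(𝕎^𝔻)ᶜᵒⁿᵗ` (`IsDoubledWeilRep χ s^𝔻`) from
a `Nonempty (FinLocalFamily χ 𝔪)` (`DoubledWeilRepresentationLocalFamilyCM.nonempty_finLocalFamily`) and an
archimedean half, and its UNIQUENESS (`DoubledWeilRepresentationUniqueness`: `DoubledWeilUniqueness.isDoubledWeilRep_unique`).
This file names the objects:
* §1 `borelPlaceMeasure` — the Haar data of record at a finite place (Borel σ-algebra, Mathlib's `Measure.addHaar`);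
* §2 `cmFinLocalFamily χ hχ 𝔪` — THE per-place package at the doubled CM datum as a TERM (`.𝓓 v = cmDatumAt … v`, i.e.
  Kudla's splitting `localSplittingDatumCM` of the doubled unitary group at every finite place, Lagrangian `ℓ_Δ`), with
  its local splittings `localSplittingAt (cmFinLocalFamily …) v = (localSplittingDatumCM L v (𝔪 v).μ n … χ hχ).localSplitting`
  definitionally;
* §3 `cmDoubledWeilRep χ hχ 𝔪 ha` — the ASSEMBLED representation `g ↦ s_∞(g_∞) · s_f(g_f)` (`assemble`) of the finite
  half `finHalf (cmFinLocalFamily …)` and an archimedean half `ha : IsArchHalf χ s_∞`: it IS a `χ`-normalised doubled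
  Weil representation (`isDoubledWeilRep_cmDoubledWeilRep`), and on `H(𝔸_f)` (in particular on every `H(L⁺_v)`) it is the
  finite half (`cmDoubledWeilRep_finAdelicToAdelic`, `cmDoubledWeilRep_locToAdelic`);
* §4 by uniqueness EVERY `χ`-normalised doubled Weil representation, and every undoubled splitting `undoubleHom`, equals
  the explicit one (`eq_cmDoubledWeilRep_of_isDoubledWeilRep`, `undoubleHom_eq_undoubleHom_cmDoubledWeilRep`) — so a
  consumer's `Classical.choose` of the existence statement rewrites BY NAME to a representation whose finite half is
  `⊗'_v (cmDatumAt v).localSplitting`.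
Nothing is asserted here; no statement of the sibling modules is changed.
-/

set_option autoImplicit false

noncomputable section

open scoped Classical
open scoped Matrix Kronecker TensorProduct
open NumberField IsDedekindDomain
open Literature.RepresentationTheory.HeisenbergGroup
open Literature.NumberTheory.Automorphic
open Literature.NumberTheory.Weil1964
open Literature.RepresentationTheory.HarrisKudlaSweet1996
open Literature.NumberTheory.GaloisRepresentations

namespace Literature.NumberTheory.GelbartRogawski1991.GRConstruction

open UnitaryDualPair

variable (L : Type) [Field L] [NumberField L] [IsCMField L]

variable {N M n : ℕ} (e : Fin N × Fin M ≃ Fin n)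
  (dV : Fin N → L) (hdV : ∀ i, IsCMField.complexConj L (dV i) = dV i) (hdV0 : ∀ i, dV i ≠ 0)
  (dW : Fin M → L) (hdW : ∀ i, IsCMField.complexConj L (dW i) = dW i) (hdW0 : ∀ i, dW i ≠ 0)

open Literature.NumberTheory.GelbartRogawski1991.UnitaryDualPair.LocalSplitting hiding IsSiegelDelta chiDet deltaBlock
  detDelta e₂ gramD gramD_isSymm gramS hermD isUnit_det_gramD
open MeasureTheory

/-! ## §1 Haar data of record -/

omit [IsCMField L] in
/-- **the Haar data of record at the finite place `v`**: the Borel σ-algebra of `L⁺_v` and Mathlib's additive Haar measure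
`Measure.addHaar` (the choice made by the undoubled local splittings `localSplittingCM`; any other choice gives the same
doubled Weil representation by `eq_cmDoubledWeilRep_of_isDoubledWeilRep`).
[cite: GelbartRogawski1991, §3.1 Prop. 3.1.1 p. 455 L1–2] -/
def borelPlaceMeasure (v : HeightOneSpectrum (𝓞 (Fp L))) : PlaceMeasure L v := by
  letI : MeasurableSpace (v.adicCompletion (Fp L)) := borel _
  haveI : BorelSpace (v.adicCompletion (Fp L)) := ⟨rfl⟩
  exact ⟨_, inferInstance, MeasureTheory.Measure.addHaar, inferInstance⟩

/-! ## §2 The per-place package at the doubled CM datum, as a term -/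

section Family

variable (χ : HeckeCharacter L) (hχ : IsSplittingChar L 1 χ) (𝔪 : ∀ v, PlaceMeasure L v)

/-- **the local parabolic normalisation of the CM datum at `v`** (`localSplittingDatumCM_parabolic` through the place-component
bridges `isSiegelDelta_locToAdelic_iff`, `isUnit_detDelta_locToAdelic_iff`, `chiDet_locToAdelic_eq_prod_dite`,
`modDelta_locToAdelic`; the computation inside `nonempty_finLocalFamily`, named).
[cite: GelbartRogawski1991, §3.1 Prop. 3.1.1 p. 455 L1–2] -/
theorem cmDatumAt_parabolicNormalised (v : HeightOneSpectrum (𝓞 (Fp L))) :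
    ParabolicNormalisedAt L e dV hdV dW hdW v χ
      (omegaAt L e dV hdV hdV0 dW hdW hdW0 (cmDatumAt L e dV hdV hdV0 dW hdW hdW0 χ hχ 𝔪 v))
      (rDeltaAt L e dV hdV hdV0 dW hdW hdW0 (cmDatumAt L e dV hdV hdV0 dW hdW hdW0 χ hχ 𝔪 v)) := by
  classical
  letI := (𝔪 v).mS; haveI := (𝔪 v).isBorel; haveI := (𝔪 v).isHaar
  intro p hS hu Φ
  have hloc := (isUnit_detDelta_locToAdelic_iff L e dV hdV dW hdW v p).1 hu
  have hp : Literature.NumberTheory.GelbartRogawski1991.UnitaryDualPair.LocalSplitting.IsSiegelDelta (Fp L) L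
      (IsCMField.complexConj L) (complexConj_imagUnit L) (imagUnit_ne_zero L) (imagUnit_mul_self L) v n
      (gramR_isSymm L e dV hdV dW hdW) (hermD_eq_map_gramD L e dV hdV dW hdW) p :=
    (isSiegelDelta_iff (Fp L) L (IsCMField.complexConj L) (complexConj_imagUnit L) (imagUnit_ne_zero L) (imagUnit_mul_self L)
      v n (gramR_isSymm L e dV hdV dW hdW) (hermD_eq_map_gramD L e dV hdV dW hdW) p).2
      fun w => (isSiegelDelta_locToAdelic_iff L e dV hdV dW hdW v p).1 hS w
  have h8 := localSplittingDatumCM_parabolic L v (𝔪 v).μ n (gramR_isSymm L e dV hdV dW hdW)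
    (isUnit_det_gramR₀ L e dV hdV hdV0 dW hdW hdW0) (hermD_eq_map_gramD L e dV hdV dW hdW) χ hχ
    (deltaLoc L e dV hdV hdV0 dW hdW hdW0 v) (map_deltaLoc_deltaLagrangian L e dV hdV hdV0 dW hdW hdW0 v) p hp Φ
  have hX := chiDet_inv (Fp L) L (IsCMField.complexConj L) v n
    (fun w' : UnitaryGroup.PlacesOver L v => χ.localComponent w'.1) p
  rw [hX, inv_inv] at h8
  rw [chiDet_locToAdelic_eq_prod_dite L e dV hdV dW hdW v χ p hloc, modDelta_locToAdelic L e dV hdV dW hdW v p hloc]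
  exact h8

include hχ in
/-- **the unramified clause of the CM data**: for almost all `v`, `H(𝒪_v)` fixes `1_{𝒪_v^{n⊕n}}` under the local Weil
representation of `cmDatumAt v` (`eventually_isGoodPlace_localComponent_inv` + `localSplittingDatumCM_unramified`).
[cite: GelbartRogawski1991, §3.1 (3.1.3) p. 456] -/
theorem cmDatumAt_unramified :
    ∀ᶠ v in Filter.cofinite,
      ∀ k ∈ UnitaryGroup.localInt L (IsCMField.complexConj L) (n + n) (hermD L e dV hdV dW hdW) v,
        omegaAt L e dV hdV hdV0 dW hdW hdW0 (cmDatumAt L e dV hdV hdV0 dW hdW hdW0 χ hχ 𝔪 v) k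
            (unitVec (Fp L) (Fin (n + n)) v) = unitVec (Fp L) (Fin (n + n)) v :=
  (eventually_isGoodPlace_localComponent_inv L n (isUnit_det_gramR₀ L e dV hdV hdV0 dW hdW hdW0) χ).mono
    fun v hgood => by
      letI := (𝔪 v).mS; haveI := (𝔪 v).isBorel; haveI := (𝔪 v).isHaar
      exact localSplittingDatumCM_unramified L v (𝔪 v).μ n (gramR_isSymm L e dV hdV dW hdW)
        (isUnit_det_gramR₀ L e dV hdV hdV0 dW hdW hdW0) (hermD_eq_map_gramD L e dV hdV dW hdW) χ hχ hgood

/-- **THE per-place package at the doubled CM datum** — the witness of `nonempty_finLocalFamily` as a TERM: Lagrangian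
`ℓ_Δ = deltaLagrangian` at every finite place, datum `cmDatumAt v` (Kudla's splitting of the doubled unitary group for the
local components of `χ⁻¹`, split or not), parabolic normalisation `cmDatumAt_parabolicNormalised`, unramified clause
`cmDatumAt_unramified`. [cite: GelbartRogawski1991, §3.1 Prop. 3.1.1 p. 455 L1–2] [cite: Kudla1994, §3 Thm. 3.1] -/
def cmFinLocalFamily : FinLocalFamily L e dV hdV hdV0 dW hdW hdW0 χ 𝔪 where
  ℓ v := deltaLagrangian (Fp L) v n
  hℓ v := deltaLagrangian_orthogonal (Fp L) v n (gramR L e dV hdV dW hdW) (isUnit_det_gramR₀ L e dV hdV hdV0 dW hdW hdW0)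
  𝓓 v := cmDatumAt L e dV hdV hdV0 dW hdW hdW0 χ hχ 𝔪 v
  parabolicNormalised v := cmDatumAt_parabolicNormalised L e dV hdV hdV0 dW hdW hdW0 χ hχ 𝔪 v
  unramified := cmDatumAt_unramified L e dV hdV hdV0 dW hdW hdW0 χ hχ 𝔪

/-- the Lagrangian of the package at `v` is `ℓ_Δ`. [cite: GelbartRogawski1991, §3.1 Prop. 3.1.1 p. 455 L1–2] -/
@[simp] theorem cmFinLocalFamily_ℓ (v : HeightOneSpectrum (𝓞 (Fp L))) :
    (cmFinLocalFamily L e dV hdV hdV0 dW hdW hdW0 χ hχ 𝔪).ℓ v = deltaLagrangian (Fp L) v n := rfl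

/-- the datum of the package at `v` is `cmDatumAt v`. [cite: GelbartRogawski1991, §3.1 Prop. 3.1.1 p. 455 L1–2] -/
@[simp] theorem cmFinLocalFamily_𝓓 (v : HeightOneSpectrum (𝓞 (Fp L))) :
    (cmFinLocalFamily L e dV hdV hdV0 dW hdW hdW0 χ hχ 𝔪).𝓓 v = cmDatumAt L e dV hdV hdV0 dW hdW hdW0 χ hχ 𝔪 v := rfl

/-- **the local splitting of the package at `v` IS Kudla's splitting of the doubled unitary group at the CM data**
(`localSplittingDatumCM … v (𝔪 v).μ …`, the datum also undoubled by `localSplittingCM`), definitionally.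
[cite: GelbartRogawski1991, §3.1 Prop. 3.1.1 p. 455 L1–2] [cite: Kudla1994, §3 Thm. 3.1] -/
theorem localSplittingAt_cmFinLocalFamily (v : HeightOneSpectrum (𝓞 (Fp L))) :
    localSplittingAt L e dV hdV hdV0 dW hdW hdW0 χ 𝔪 (cmFinLocalFamily L e dV hdV hdV0 dW hdW hdW0 χ hχ 𝔪) v =
      (by
        letI := (𝔪 v).mS; haveI := (𝔪 v).isBorel; haveI := (𝔪 v).isHaar
        exact (localSplittingDatumCM L v (𝔪 v).μ n (T₀ := gramR L e dV hdV dW hdW) (gramR_isSymm L e dV hdV dW hdW)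
          (isUnit_det_gramR₀ L e dV hdV hdV0 dW hdW hdW0) (JD := hermD L e dV hdV dW hdW)
          (hermD_eq_map_gramD L e dV hdV dW hdW) χ hχ).localSplitting) := rfl

/-- the same at the Haar data of record: **`s_v = (localSplittingDatumCM L v addHaar …).localSplitting`** with the Borel
σ-algebra — the doubled splitting inside `localSplittingCM … v` token for token (up to the Gram-matrix spelling
`T₀ := gramR …`). [cite: GelbartRogawski1991, §3.1 Prop. 3.1.1 p. 455 L1–2] [cite: Kudla1994, §3 Thm. 3.1] -/
theorem localSplittingAt_cmFinLocalFamily_borel (v : HeightOneSpectrum (𝓞 (Fp L))) :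
    localSplittingAt L e dV hdV hdV0 dW hdW hdW0 χ (borelPlaceMeasure L)
        (cmFinLocalFamily L e dV hdV hdV0 dW hdW hdW0 χ hχ (borelPlaceMeasure L)) v =
      (by
        letI : MeasurableSpace (v.adicCompletion (Fp L)) := borel _
        haveI : BorelSpace (v.adicCompletion (Fp L)) := ⟨rfl⟩
        exact (localSplittingDatumCM L v MeasureTheory.Measure.addHaar n (T₀ := gramR L e dV hdV dW hdW)
          (gramR_isSymm L e dV hdV dW hdW) (isUnit_det_gramR₀ L e dV hdV hdV0 dW hdW hdW0) (JD := hermD L e dV hdV dW hdW)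
          (hermD_eq_map_gramD L e dV hdV dW hdW) χ hχ).localSplitting) := rfl

/-- the same in the ARGUMENT SPELLING of the undoubled local splitting `localSplittingCM … v` (doubled form
`J^𝔻 := (T^𝔻).map (algebraMap L⁺ L)` with `hJD := rfl`, as inside `localSplittingCMWith`): the two doubled data are the
same term up to unfolding `hermD` (`hermD_eq_map_gramD` is `rfl`), so the (H3) square meets `undoubleLoc` on the nose.
[cite: GelbartRogawski1991, §3.1 Prop. 3.1.1 p. 455 L1–2] [cite: Kudla1994, §3 Thm. 3.1] -/
theorem localSplittingAt_cmFinLocalFamily_borel' (v : HeightOneSpectrum (𝓞 (Fp L))) :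
    localSplittingAt L e dV hdV hdV0 dW hdW hdW0 χ (borelPlaceMeasure L)
        (cmFinLocalFamily L e dV hdV hdV0 dW hdW hdW0 χ hχ (borelPlaceMeasure L)) v =
      (by
        letI : MeasurableSpace (v.adicCompletion (Fp L)) := borel _
        haveI : BorelSpace (v.adicCompletion (Fp L)) := ⟨rfl⟩
        exact (localSplittingDatumCM L v MeasureTheory.Measure.addHaar n (T₀ := gramR L e dV hdV dW hdW)
          (gramR_isSymm L e dV hdV dW hdW) (isUnit_det_gramR₀ L e dV hdV hdV0 dW hdW hdW0)
          (JD := (Literature.NumberTheory.GelbartRogawski1991.UnitaryDualPair.LocalSplitting.gramD (Fp L) n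
            (gramR L e dV hdV dW hdW)).map (algebraMap (Fp L) L)) rfl χ hχ).localSplitting) := rfl

/-- the finite half of a package is the restricted tensor product `finSplitting` of its local splittings (unfolding, for
the place-by-place API `omega_finSplitting_tmul` ∕ `Omega_piProdSB` of `FiniteAdelicSplittingAssembly`).
[cite: GelbartRogawski1991, §3.1 Prop. 3.1.1 p. 455 L1–2] -/
theorem finHalf_eq_finSplitting (𝓕 : FinLocalFamily L e dV hdV hdV0 dW hdW hdW0 χ 𝔪) :
    finHalf L e dV hdV hdV0 dW hdW hdW0 χ 𝔪 𝓕 = (finSplittings L e dV hdV hdV0 dW hdW hdW0 χ 𝔪 𝓕).finSplitting := rfl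

/-- the local splitting of the `FinLocalSplittings` of a package at `v` is `localSplittingAt … v` (unfolding).
[cite: GelbartRogawski1991, §3.1 Prop. 3.1.1 p. 455 L1–2] -/
theorem finSplittings_s (𝓕 : FinLocalFamily L e dV hdV hdV0 dW hdW hdW0 χ 𝔪) (v : HeightOneSpectrum (𝓞 (Fp L))) :
    (finSplittings L e dV hdV hdV0 dW hdW hdW0 χ 𝔪 𝓕).s v = localSplittingAt L e dV hdV hdV0 dW hdW hdW0 χ 𝔪 𝓕 v := rfl

end Family

/-! ## §3 The assembled representation, explicitly -/

section Assembled

variable (χ : HeckeCharacter L) (hχ : IsSplittingChar L 1 χ) (𝔪 : ∀ v, PlaceMeasure L v)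
  {sa : UnitaryGroup.arch (Fp L) L (IsCMField.complexConj L) (n + n) (hermD L e dV hdV dW hdW) →* MpD L e dV hdV dW hdW}

/-- **THE doubled Weil representation at the CM datum, explicitly**: `s^𝔻(g) := s_∞(g_∞) · s_f(g_f)` (`assemble`) with
`s_f := finHalf (cmFinLocalFamily χ hχ 𝔪) = ⊗'_v (cmDatumAt v).localSplitting` and `s_∞` an archimedean half
`ha : IsArchHalf χ s_∞` (these exist: `exists_isArchHalf`). [cite: GelbartRogawski1991, §3.1 Prop. 3.1.1 p. 455 L1–2]
[cite: HarrisKudlaSweet1996, §1 (1.11)–(1.16)] -/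
def cmDoubledWeilRep (ha : IsArchHalf L e dV hdV hdV0 dW hdW hdW0 χ sa) : HA L e dV hdV dW hdW →* MpD L e dV hdV dW hdW :=
  assemble L e dV hdV hdV0 dW hdW hdW0
    (finHalf_isFinHalf L e dV hdV hdV0 dW hdW hdW0 χ 𝔪 (cmFinLocalFamily L e dV hdV hdV0 dW hdW hdW0 χ hχ 𝔪)) ha

/-- **`cmDoubledWeilRep` IS a `χ`-normalised doubled Weil representation**: continuous, over `ι^𝔻`, with the prescribed
normalisation on `P_Δ(𝔸)` (`S1asm_continuous`, `proj_assemble`, `S1asm_parabolic` at the explicit finite half).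
[cite: GelbartRogawski1991, §3.1 Prop. 3.1.1 p. 455 L1–2] [cite: HarrisKudlaSweet1996, §1 (1.11)–(1.16)] -/
theorem isDoubledWeilRep_cmDoubledWeilRep (ha : IsArchHalf L e dV hdV hdV0 dW hdW hdW0 χ sa) :
    IsDoubledWeilRep L e dV hdV hdV0 dW hdW hdW0 χ (cmDoubledWeilRep L e dV hdV hdV0 dW hdW hdW0 χ hχ 𝔪 ha) where
  continuous := S1asm_continuous L e dV hdV hdV0 dW hdW hdW0
    (finHalf_isFinHalf L e dV hdV hdV0 dW hdW hdW0 χ 𝔪 (cmFinLocalFamily L e dV hdV hdV0 dW hdW hdW0 χ hχ 𝔪)) ha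
  proj_eq := proj_assemble L e dV hdV hdV0 dW hdW hdW0
    (finHalf_isFinHalf L e dV hdV hdV0 dW hdW hdW0 χ 𝔪 (cmFinLocalFamily L e dV hdV hdV0 dW hdW hdW0 χ hχ 𝔪)) ha
  parabolic := S1asm_parabolic L e dV hdV hdV0 dW hdW hdW0
    (finHalf_isFinHalf L e dV hdV hdV0 dW hdW hdW0 χ 𝔪 (cmFinLocalFamily L e dV hdV hdV0 dW hdW hdW0 χ hχ 𝔪)) ha

/-- **`s^𝔻(g) = s_∞(g_∞) · s_f(g_f)`** (unfolding of `assemble`). [cite: HarrisKudlaSweet1996, §1 (1.11)–(1.16)] -/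
theorem cmDoubledWeilRep_apply (ha : IsArchHalf L e dV hdV hdV0 dW hdW hdW0 χ sa) (g : HA L e dV hdV dW hdW) :
    cmDoubledWeilRep L e dV hdV hdV0 dW hdW hdW0 χ hχ 𝔪 ha g =
      sa (UnitaryGroup.archPart (Fp L) L (IsCMField.complexConj L) (n + n) (hermD L e dV hdV dW hdW) g) *
        finHalf L e dV hdV hdV0 dW hdW hdW0 χ 𝔪 (cmFinLocalFamily L e dV hdV hdV0 dW hdW hdW0 χ hχ 𝔪)
          (UnitaryGroup.finPart (Fp L) L (IsCMField.complexConj L) (n + n) (hermD L e dV hdV dW hdW) g) := by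
  unfold cmDoubledWeilRep assemble
  rfl

/-- **on `H(𝔸_f)` the representation IS the finite half**: `s^𝔻((1, g_f)) = s_f(g_f)`.
[cite: HarrisKudlaSweet1996, §1 (1.11)–(1.16)] -/
theorem cmDoubledWeilRep_finAdelicToAdelic (ha : IsArchHalf L e dV hdV hdV0 dW hdW hdW0 χ sa)
    (b : UnitaryGroup.finAdelic (Fp L) L (IsCMField.complexConj L) (n + n) (hermD L e dV hdV dW hdW)) :
    cmDoubledWeilRep L e dV hdV hdV0 dW hdW hdW0 χ hχ 𝔪 ha
        (UnitaryGroup.finAdelicToAdelic (Fp L) L (IsCMField.complexConj L) (n + n) (hermD L e dV hdV dW hdW) b) =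
      finHalf L e dV hdV hdV0 dW hdW hdW0 χ 𝔪 (cmFinLocalFamily L e dV hdV hdV0 dW hdW hdW0 χ hχ 𝔪) b := by
  have h := cmDoubledWeilRep_apply L e dV hdV hdV0 dW hdW hdW0 χ hχ 𝔪 ha
    (UnitaryGroup.finAdelicToAdelic (Fp L) L (IsCMField.complexConj L) (n + n) (hermD L e dV hdV dW hdW) b)
  simp only [UnitaryGroup.archPart_finAdelicToAdelic, UnitaryGroup.finPart_finAdelicToAdelic, map_one, one_mul] at h
  exact h

/-- **on `H(L⁺ ⊗ ℝ)` the representation IS the archimedean half**: `s^𝔻((g_∞, 1)) = s_∞(g_∞)`.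
[cite: HarrisKudlaSweet1996, §1 (1.11)–(1.16)] -/
theorem cmDoubledWeilRep_archToAdelic (ha : IsArchHalf L e dV hdV hdV0 dW hdW hdW0 χ sa)
    (a : UnitaryGroup.arch (Fp L) L (IsCMField.complexConj L) (n + n) (hermD L e dV hdV dW hdW)) :
    cmDoubledWeilRep L e dV hdV hdV0 dW hdW hdW0 χ hχ 𝔪 ha
        (UnitaryGroup.archToAdelic (Fp L) L (IsCMField.complexConj L) (n + n) (hermD L e dV hdV dW hdW) a) = sa a := by
  have h := cmDoubledWeilRep_apply L e dV hdV hdV0 dW hdW hdW0 χ hχ 𝔪 ha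
    (UnitaryGroup.archToAdelic (Fp L) L (IsCMField.complexConj L) (n + n) (hermD L e dV hdV dW hdW) a)
  simp only [UnitaryGroup.archPart_archToAdelic, UnitaryGroup.finPart_archToAdelic, map_one, mul_one] at h
  exact h

/-- **at one finite place**: `s^𝔻(p ↦ (1, …, p, …, 1)) = s_f(inclPlace v p)` (`locToAdelic = finAdelicToAdelic ∘ inclPlace`).
[cite: HarrisKudlaSweet1996, §1 (1.11)–(1.16)] -/
theorem cmDoubledWeilRep_locToAdelic (ha : IsArchHalf L e dV hdV hdV0 dW hdW hdW0 χ sa) (v : HeightOneSpectrum (𝓞 (Fp L)))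
    (u : UnitaryGroup.localPi L (IsCMField.complexConj L) (n + n) (hermD L e dV hdV dW hdW) v) :
    cmDoubledWeilRep L e dV hdV hdV0 dW hdW hdW0 χ hχ 𝔪 ha (locToAdelic L e dV hdV dW hdW v u) =
      finHalf L e dV hdV hdV0 dW hdW hdW0 χ 𝔪 (cmFinLocalFamily L e dV hdV hdV0 dW hdW hdW0 χ hχ 𝔪)
        (UnitaryGroup.inclPlace (Fp L) L (IsCMField.complexConj L) (n + n) (hermD L e dV hdV dW hdW) v u) :=
  cmDoubledWeilRep_finAdelicToAdelic L e dV hdV hdV0 dW hdW hdW0 χ hχ 𝔪 ha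
    (UnitaryGroup.inclPlace (Fp L) L (IsCMField.complexConj L) (n + n) (hermD L e dV hdV dW hdW) v u)

/-! ## §4 Every doubled Weil representation along `χ` is the explicit one -/

/-- **uniqueness transfer**: ANY `χ`-normalised doubled Weil representation `sD` equals the explicit one, for any Haar
data `𝔪` and any archimedean half (`DoubledWeilUniqueness.isDoubledWeilRep_unique`); in particular a consumer's
`Classical.choose` of the existence statement does. [cite: GelbartRogawski1991, §3.1 Prop. 3.1.1 p. 455 L1–2]
[cite: Kudla1996, Chap. I §6 Lemma 6.3 (castle.pdf pp. 16–18)] -/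
theorem eq_cmDoubledWeilRep_of_isDoubledWeilRep (ha : IsArchHalf L e dV hdV hdV0 dW hdW hdW0 χ sa)
    {sD : HA L e dV hdV dW hdW →* MpD L e dV hdV dW hdW} (h : IsDoubledWeilRep L e dV hdV hdV0 dW hdW hdW0 χ sD) :
    sD = cmDoubledWeilRep L e dV hdV hdV0 dW hdW hdW0 χ hχ 𝔪 ha :=
  DoubledWeilUniqueness.isDoubledWeilRep_unique L e dV hdV hdV0 dW hdW hdW0 χ h
    (isDoubledWeilRep_cmDoubledWeilRep L e dV hdV hdV0 dW hdW hdW0 χ hχ 𝔪 ha)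

/-- hence ANY `χ`-normalised doubled Weil representation restricts on `H(𝔸_f)` to the explicit finite half
`⊗'_v (cmDatumAt v).localSplitting`. [cite: GelbartRogawski1991, §3.1 Prop. 3.1.1 p. 455 L1–2]
[cite: Kudla1996, Chap. I §6 Lemma 6.3 (castle.pdf pp. 16–18)] -/
theorem apply_finAdelicToAdelic_of_isDoubledWeilRep (ha : IsArchHalf L e dV hdV hdV0 dW hdW hdW0 χ sa)
    {sD : HA L e dV hdV dW hdW →* MpD L e dV hdV dW hdW} (h : IsDoubledWeilRep L e dV hdV hdV0 dW hdW hdW0 χ sD)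
    (b : UnitaryGroup.finAdelic (Fp L) L (IsCMField.complexConj L) (n + n) (hermD L e dV hdV dW hdW)) :
    sD (UnitaryGroup.finAdelicToAdelic (Fp L) L (IsCMField.complexConj L) (n + n) (hermD L e dV hdV dW hdW) b) =
      finHalf L e dV hdV hdV0 dW hdW hdW0 χ 𝔪 (cmFinLocalFamily L e dV hdV hdV0 dW hdW hdW0 χ hχ 𝔪) b := by
  rw [eq_cmDoubledWeilRep_of_isDoubledWeilRep L e dV hdV hdV0 dW hdW hdW0 χ hχ 𝔪 ha h]
  exact cmDoubledWeilRep_finAdelicToAdelic L e dV hdV hdV0 dW hdW hdW0 χ hχ 𝔪 ha b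

/-- **the undoubled splitting of ANY `χ`-normalised doubled Weil representation is that of the explicit one**
(`DoubledWeilUniqueness.undoubleHom_unique`): the compatible splitting `s_χ = undoubleHom sD` of `U(V ⊗ W)(𝔸)` consumed
downstream is `undoubleHom (cmDoubledWeilRep χ hχ 𝔪 ha)`. [cite: GelbartRogawski1991, §3.2 p. 457]
[cite: Kudla1996, Chap. I §6 Lemma 6.3 (castle.pdf pp. 16–18)] -/
theorem undoubleHom_eq_undoubleHom_cmDoubledWeilRep (ha : IsArchHalf L e dV hdV hdV0 dW hdW hdW0 χ sa)
    {sD : HA L e dV hdV dW hdW →* MpD L e dV hdV dW hdW} (h : IsDoubledWeilRep L e dV hdV hdV0 dW hdW hdW0 χ sD) :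
    undoubleHom L e dV hdV hdV0 dW hdW hdW0 sD h.proj_eq =
      undoubleHom L e dV hdV hdV0 dW hdW hdW0 (cmDoubledWeilRep L e dV hdV hdV0 dW hdW hdW0 χ hχ 𝔪 ha)
        (isDoubledWeilRep_cmDoubledWeilRep L e dV hdV hdV0 dW hdW hdW0 χ hχ 𝔪 ha).proj_eq :=
  DoubledWeilUniqueness.undoubleHom_unique L e dV hdV hdV0 dW hdW hdW0 χ h
    (isDoubledWeilRep_cmDoubledWeilRep L e dV hdV hdV0 dW hdW hdW0 χ hχ 𝔪 ha)

/-- the explicit representation does not depend on the Haar data or on the archimedean half chosen.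
[cite: GelbartRogawski1991, §3.1 Prop. 3.1.1 p. 455 L1–2] [cite: Kudla1996, Chap. I §6 Lemma 6.3 (castle.pdf pp. 16–18)] -/
theorem cmDoubledWeilRep_eq_cmDoubledWeilRep (ha : IsArchHalf L e dV hdV hdV0 dW hdW hdW0 χ sa) (𝔪' : ∀ v, PlaceMeasure L v)
    {sa' : UnitaryGroup.arch (Fp L) L (IsCMField.complexConj L) (n + n) (hermD L e dV hdV dW hdW) →* MpD L e dV hdV dW hdW}
    (ha' : IsArchHalf L e dV hdV hdV0 dW hdW hdW0 χ sa') :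
    cmDoubledWeilRep L e dV hdV hdV0 dW hdW hdW0 χ hχ 𝔪' ha' = cmDoubledWeilRep L e dV hdV hdV0 dW hdW hdW0 χ hχ 𝔪 ha :=
  eq_cmDoubledWeilRep_of_isDoubledWeilRep L e dV hdV hdV0 dW hdW hdW0 χ hχ 𝔪 ha
    (isDoubledWeilRep_cmDoubledWeilRep L e dV hdV hdV0 dW hdW hdW0 χ hχ 𝔪' ha')

end Assembled

/-! ### Build-lane note (ops-buildfix G11b-3 recipe, LEDGER B13-1, 2026-08-21)
`lean -o` (the hub build lane, never `lean`/the gate check) runs Lean 4.32's library-suggestion indexers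
(`Lean.LibrarySuggestions.SymbolFrequency` / `SineQuaNon`, from their `exportEntriesFn`) over the statement of
every local theorem that is not a denied premise; on this family's statements (very large dependent binder
telescopes through the theta-kernel / dual-pair data) that fold runs for tens of minutes to hours and the build
lane kills the job (incident G11b-3, run/shared/lean/ops/buildfix/G11b-3-DOSSIER.md). `isDeniedPremise` skips
`[implicit_reducible]` constants before any fold, and a reducibility status on a *theorem* is inert (Meta never
unfolds `thmInfo`; the kernel ignores the attribute), so the public theorems of this file are tagged
`[implicit_reducible]` purely to keep them out of that index. Only other effect: they are not offered by
`+suggestions` premise selectors. No statement or proof is changed; superseded if the operator lands a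
deny-list form (`HarnessLib.PremiseIndex`). -/
set_option allowUnsafeReducibility true in
attribute [implicit_reducible]
  cmDatumAt_parabolicNormalised cmDatumAt_unramified cmFinLocalFamily_ℓ cmFinLocalFamily_𝓓
  localSplittingAt_cmFinLocalFamily localSplittingAt_cmFinLocalFamily_borel localSplittingAt_cmFinLocalFamily_borel'
  finHalf_eq_finSplitting finSplittings_s isDoubledWeilRep_cmDoubledWeilRep
  cmDoubledWeilRep_apply cmDoubledWeilRep_finAdelicToAdelic cmDoubledWeilRep_archToAdelic
  cmDoubledWeilRep_locToAdelic eq_cmDoubledWeilRep_of_isDoubledWeilRep apply_finAdelicToAdelic_of_isDoubledWeilRep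
  undoubleHom_eq_undoubleHom_cmDoubledWeilRep cmDoubledWeilRep_eq_cmDoubledWeilRep

end Literature.NumberTheory.GelbartRogawski1991.GRConstruction
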